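import Mathlib.LinearAlgebra.Matrix.NonsingularInverse
import Mathlib.NumberTheory.PrimeCounting
import Summits.RiemannHypothesis.RiemannHypothesis.Theorems.NymanBeurlingGramPosDef
import HarnessLib

/-!
# RiemannHypothesis / Nyman–Beurling — the Báez-Duarte MINIMISER `c⋆_N = G⁻¹ b`: normal equations, the distance as an
exact quadratic programme, minimality & uniqueness, `d_N² = 1 − b·c⋆_N`, `0 < d_N² ≤ 1` (RH-FREE per N)

Column LI/NB of the RH ladder, rung L-P(P2) «structure of the NB minimiser», PROOF-OF-DATA for cell `pub/rh-li`
(sequel of `NymanBeurlingGramPosDef.lean`).  The DATA rung (DATA.md §L: certified lineages R / A at every `N ≤ 10⁴`,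
float lineage C2) computes, by exact / certified linear algebra, the vector `c⋆_N = G⁻¹ b` and the number `1 − bᵀc⋆_N`.
This file proves, for EVERY `N`, that these ARE Báez-Duarte's objects:

* `nbMinimiser_normalEq`, `eq_nbMinimiser_of_normalEq`: `c⋆_N` solves the normal equations `G c = b`, and is their only
  solution (so the «for every solution of the normal equations» theorems T2/T3 of the rung are statements about `c⋆_N`:
  `nbTailConstIdentity_nbMinimiser`, and `nbHeadTailIdentity'` in the prequel);
* `nbDistSq_eq_quadratic`: `d_N²(c) = ‖χ − Σ c_k ρ_{k+1}‖²_{L²(0,∞)} = 1 − 2 b·c + c·Gc` — the exact QP;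
* `nbDistSq_sub_nbDistSq_nbMinimiser` (completing the square), `nbDistSq_nbMinimiser_le` (MINIMALITY: `c⋆_N` attains
  Báez-Duarte's infimum over `Fin N → ℝ`), `nbDistSq_eq_nbDistSq_nbMinimiser_iff` (UNIQUENESS);
* `nbDistSq_nbMinimiser`: **`d_N² = 1 − Σ_k c⋆_k b_k`** — the formula behind every certified `d²` row;
* `nbDistSq_pos` (`d_N²(c) > 0` for every `c`: `χ` is not a finite combination of dilates — differencing the cell
  bookkeeping at `m = 1` and at a prime `p > N`), `nbDistSq_nbMinimiser_le_one`; so `κ_N = tailConst(c⋆_N)/d_N²` is never a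
  junk value, and `tailConst_nbMinimiser_sq_le` bounds it (`(2 − 2log²2) κ_N² d_N² ≤ 1`).

RH-FREE [rh-li-eng-3]: finite-`N` linear algebra and Lebesgue integrals; no statement about `d_N → 0` is made or used; the
criterion `RH ⇔ d_N → 0` (`baezDuarte_iff_holds`) is RH-EQUIVALENT and untouched.  Nothing here bears on the truth of RH.
-/

noncomputable section

-- D-0017: `Summit.<S>.<S>.…` is the designed namespace of a single-problem summit.
set_option linter.dupNamespace false

open MeasureTheory Set Finset
open scoped Matrix

namespace Summit.RiemannHypothesis.RiemannHypothesis.Theorems.NbTheory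

open Literature.NumberTheory.LFunctions Literature.NumberTheory.LFunctions.BaezDuarteOnlyIf
open GramPosDef

namespace Minimiser

/-! ## The normal equations hold for `c⋆_N = G⁻¹ b`, and only for it -/

/-- `G c⋆ = b` (the Gram matrix is invertible: `nbGramMatrix_posDef`). -/
theorem nbGramMatrix_mulVec_nbMinimiser (N : ℕ) :
    nbGramMatrix N *ᵥ nbMinimiser N = fun k : Fin N ↦ nbRhs k := by
  have hdet : IsUnit (nbGramMatrix N).det :=
    (Matrix.isUnit_iff_isUnit_det _).1 (nbGramMatrix_posDef N).isUnit
  unfold nbMinimiser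
  rw [Matrix.mulVec_mulVec, Matrix.mul_nonsing_inv _ hdet, Matrix.one_mulVec]

end Minimiser

open Minimiser

/-- **The normal equations for the DATA object `c⋆_N = G⁻¹ b` (RH-FREE per N):** `Σ_j G_{kj} c⋆_j = b_k` for every `k`.
Hence every «for every solution of the normal equations» statement of rung L-P(P2) (T2, T3) applies to `nbMinimiser N`. -/
theorem nbMinimiser_normalEq (N : ℕ) (k : Fin N) :
    ∑ j : Fin N, nbGram k j * nbMinimiser N j = nbRhs k := by
  have h := congrFun (nbGramMatrix_mulVec_nbMinimiser N) k
  simpa [Matrix.mulVec, dotProduct, nbGramMatrix] using h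

/-- **Uniqueness (RH-FREE per N):** the normal equations have exactly one solution, `nbMinimiser N`. -/
theorem eq_nbMinimiser_of_normalEq {N : ℕ} {c : Fin N → ℝ}
    (h : ∀ k : Fin N, ∑ j : Fin N, nbGram k j * c j = nbRhs k) : c = nbMinimiser N := by
  have hinj : Function.Injective (nbGramMatrix N).mulVec :=
    Matrix.mulVec_injective_iff_isUnit.2 (nbGramMatrix_posDef N).isUnit
  apply hinj
  rw [nbGramMatrix_mulVec_nbMinimiser]
  funext k
  simpa [Matrix.mulVec, dotProduct, nbGramMatrix] using h k

namespace Minimiser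

/-! ## The distance as a quadratic function of the coefficients -/

/-- `ρ_{k+1}` is integrable on `(0,1]`. -/
lemma integrableOn_nbRho (k : ℕ) : IntegrableOn (nbRho k) (Set.Ioc (0 : ℝ) 1) :=
  integrableOn_Ioc_of_bounded (measurable_nbRho k) (abs_nbRho_le k)

/-- `∫_{(0,1]} f_c = Σ_k c_k b_k`. -/
lemma integral_sum_mul_nbRho {N : ℕ} (c : Fin N → ℝ) :
    ∫ x in Set.Ioc (0 : ℝ) 1, ∑ k : Fin N, c k * nbRho k x = ∑ k : Fin N, c k * nbRhs k := by
  rw [integral_finsetSum _ (fun (k : Fin N) _ ↦ (integrableOn_nbRho (k : ℕ)).const_mul (c k))]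
  refine Finset.sum_congr rfl fun k _ ↦ ?_
  rw [integral_const_mul]
  rfl

/-- On `(0,1]` the Báez-Duarte integrand is `1 − f_c`. -/
lemma approx_eq_of_mem_Ioc {N : ℕ} (c : Fin N → ℝ) {x : ℝ} (hx : x ∈ Set.Ioc (0 : ℝ) 1) :
    approx c x = 1 - ∑ k : Fin N, c k * nbRho k x := by
  rw [approx, Set.indicator_of_mem hx]
  rfl

/-- HEAD + TAIL: `d_N²(c) = ∫_{(0,1]} (1 − f_c)² + tailConst(c)²`. -/
theorem nbDistSq_eq_head_add_tail {N : ℕ} (c : Fin N → ℝ) :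
    nbDistSq N c = (∫ x in Set.Ioc (0 : ℝ) 1, (1 - ∑ k : Fin N, c k * nbRho k x) ^ 2) + tailConst c ^ 2 := by
  have hint := integrableOn_sq_approx c
  have hsplit : ∫ x in Set.Ioi (0 : ℝ), approx c x ^ 2 =
      (∫ x in Set.Ioc (0 : ℝ) 1, approx c x ^ 2) + ∫ x in Set.Ioi (1 : ℝ), approx c x ^ 2 := by
    rw [← Set.Ioc_union_Ioi_eq_Ioi zero_le_one,
      setIntegral_union Set.Ioc_disjoint_Ioi_same measurableSet_Ioi
        (hint.mono_set Set.Ioc_subset_Ioi_self) (hint.mono_set (Set.Ioi_subset_Ioi zero_le_one))]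
  rw [nbDistSq_eq_integral, hsplit, integral_Ioi_one_sq_approx,
    setIntegral_congr_fun measurableSet_Ioc fun x hx ↦ by rw [approx_eq_of_mem_Ioc c hx]]

/-- **`d_N²(c)` is the quadratic `1 − 2 b·c + c·Gc` (RH-FREE per N)** — the exact QP the DATA rung solves. -/
theorem nbDistSq_eq_quadratic {N : ℕ} (c : Fin N → ℝ) :
    nbDistSq N c = 1 - 2 * ∑ k : Fin N, c k * nbRhs k + c ⬝ᵥ (nbGramMatrix N *ᵥ c) := by
  rw [dotProduct_nbGramMatrix_mulVec, dotProduct_nbGram0Matrix_mulVec, nbDistSq_eq_head_add_tail]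
  have hf : IntegrableOn (fun x : ℝ ↦ ∑ k : Fin N, c k * nbRho k x) (Set.Ioc (0 : ℝ) 1) :=
    integrableOn_Ioc_of_bounded (measurable_sum_mul_nbRho c) (abs_sum_mul_nbRho_le c)
  have hf2 : IntegrableOn (fun x : ℝ ↦ (∑ k : Fin N, c k * nbRho k x) ^ 2) (Set.Ioc (0 : ℝ) 1) := by
    have := integrableOn_sq_const_sub c 0
    simpa only [zero_sub, even_two.neg_pow] using this
  have h1 : IntegrableOn (fun _ : ℝ ↦ (1 : ℝ)) (Set.Ioc (0 : ℝ) 1) :=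
    integrableOn_Ioc_of_bounded measurable_const (M := 1) fun _ ↦ by simp
  have hexp : ∀ x : ℝ, (1 - ∑ k : Fin N, c k * nbRho k x) ^ 2 =
      (1 - 2 * ∑ k : Fin N, c k * nbRho k x) + (∑ k : Fin N, c k * nbRho k x) ^ 2 := fun x ↦ by ring
  have h2f : IntegrableOn (fun x : ℝ ↦ 2 * ∑ k : Fin N, c k * nbRho k x) (Set.Ioc (0 : ℝ) 1) := hf.const_mul 2
  have h12 : IntegrableOn (fun x : ℝ ↦ 1 - 2 * ∑ k : Fin N, c k * nbRho k x) (Set.Ioc (0 : ℝ) 1) := h1.sub h2f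
  rw [setIntegral_congr_fun measurableSet_Ioc fun x _ ↦ hexp x, integral_add h12 hf2, integral_sub h1 h2f,
    integral_const_mul, integral_sum_mul_nbRho, setIntegral_const, smul_eq_mul, mul_one, measureReal_def,
    Real.volume_Ioc, ENNReal.toReal_ofReal (by norm_num : (0 : ℝ) ≤ 1 - 0)]
  ring

/-! ## Minimality and uniqueness of the minimiser; the value `d_N² = 1 − b·c⋆` -/

/-- `b·c = c·(G c⋆)`. -/
lemma sum_mul_nbRhs_eq_dotProduct {N : ℕ} (c : Fin N → ℝ) :
    ∑ k : Fin N, c k * nbRhs k = c ⬝ᵥ (nbGramMatrix N *ᵥ nbMinimiser N) := by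
  rw [nbGramMatrix_mulVec_nbMinimiser]
  rfl

/-- Symmetry of the form: `c⋆·(G c) = c·(G c⋆)`. -/
lemma dotProduct_mulVec_comm {N : ℕ} (u v : Fin N → ℝ) :
    u ⬝ᵥ (nbGramMatrix N *ᵥ v) = v ⬝ᵥ (nbGramMatrix N *ᵥ u) := by
  have hH : (nbGramMatrix N).IsHermitian := nbGramMatrix_isHermitian N
  have hT : (nbGramMatrix N).transpose = nbGramMatrix N := by
    rw [← Matrix.conjTranspose_eq_transpose_of_trivial]
    exact hH.eq
  rw [Matrix.dotProduct_mulVec, ← Matrix.mulVec_transpose, hT, dotProduct_comm]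

/-- **Completing the square (RH-FREE per N):** `d_N²(c) − d_N²(c⋆) = (c − c⋆)·G(c − c⋆)`. -/
theorem nbDistSq_sub_nbDistSq_nbMinimiser {N : ℕ} (c : Fin N → ℝ) :
    nbDistSq N c - nbDistSq N (nbMinimiser N) =
      (c - nbMinimiser N) ⬝ᵥ (nbGramMatrix N *ᵥ (c - nbMinimiser N)) := by
  rw [nbDistSq_eq_quadratic, nbDistSq_eq_quadratic, sum_mul_nbRhs_eq_dotProduct, sum_mul_nbRhs_eq_dotProduct]
  simp only [Matrix.mulVec_sub, dotProduct_sub, sub_dotProduct,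
    dotProduct_mulVec_comm (nbMinimiser N) c]
  ring

end Minimiser

open Minimiser

/-- **MINIMALITY (RH-FREE per N):** the DATA object `c⋆_N = G⁻¹ b` attains the least squared distance:
`d_N²(c⋆_N) ≤ d_N²(c)` for every coefficient vector `c` — i.e. `nbDistSq N (nbMinimiser N)` IS Báez-Duarte's `d_N²`. -/
theorem nbDistSq_nbMinimiser_le {N : ℕ} (c : Fin N → ℝ) :
    nbDistSq N (nbMinimiser N) ≤ nbDistSq N c := by
  have h := nbDistSq_sub_nbDistSq_nbMinimiser c
  have hnn : 0 ≤ (c - nbMinimiser N) ⬝ᵥ (nbGramMatrix N *ᵥ (c - nbMinimiser N)) := by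
    have := (nbGramMatrix_posDef N).posSemidef.dotProduct_mulVec_nonneg (c - nbMinimiser N)
    rwa [star_trivial] at this
  linarith

/-- **UNIQUENESS of the minimiser (RH-FREE per N):** `d_N²(c) = d_N²(c⋆_N)` iff `c = c⋆_N`. -/
theorem nbDistSq_eq_nbDistSq_nbMinimiser_iff {N : ℕ} (c : Fin N → ℝ) :
    nbDistSq N c = nbDistSq N (nbMinimiser N) ↔ c = nbMinimiser N := by
  refine ⟨fun h ↦ ?_, fun h ↦ by rw [h]⟩
  by_contra hne
  have hpos := (nbGramMatrix_posDef N).dotProduct_mulVec_pos (sub_ne_zero.2 hne)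
  rw [star_trivial, ← nbDistSq_sub_nbDistSq_nbMinimiser] at hpos
  linarith

/-- **THE VALUE (RH-FREE per N):** `d_N² = 1 − Σ_k c⋆_k b_k` — exactly the formula behind every certified `d²` row
of the DATA rung (`d² = 1 − bᵀx`, DATA.md §L). -/
theorem nbDistSq_nbMinimiser (N : ℕ) :
    nbDistSq N (nbMinimiser N) = 1 - ∑ k : Fin N, nbMinimiser N k * nbRhs k := by
  rw [nbDistSq_eq_quadratic, ← sum_mul_nbRhs_eq_dotProduct]
  ring

namespace Minimiser

/-- Divisor bookkeeping: if every divisor of `q` that is `≤ N` equals `1`, then `Σ_{(k+1) ∣ q} c_k = c_0`. -/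
lemma sum_ite_dvd_eq_head {N : ℕ} (c : Fin N → ℝ) (hN : 0 < N) {q : ℕ}
    (hq : ∀ d : ℕ, d ∣ q → d ≤ N → d = 1) :
    ∑ k : Fin N, (if (k : ℕ) + 1 ∣ q then c k else 0) = c ⟨0, hN⟩ := by
  rw [Finset.sum_eq_single ⟨0, hN⟩]
  · simp
  · intro k _ hk
    split_ifs with hd
    · exfalso
      have h1 := hq _ hd (by have := k.isLt; omega)
      apply hk
      ext
      simp only
      omega
    · rfl
  · simp

end Minimiser

/-- **`d_N² > 0` for every `N` and every coefficient vector (RH-FREE):** `χ` is not a finite combination of dilates.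
(If `d_N²(c) = 0` then `τ = 0` and `f_c ≡ 1` a.e. on `(0,1]`, i.e. `D_c(m) = −1` for all `m ≥ 1`; differencing at
`m = 1` gives `c_0 = −1`, at a prime `p > N` gives `c_0 = 0`.)  So `κ_N = tailConst(c⋆_N)/d_N²` is never a junk value. -/
theorem nbDistSq_pos {N : ℕ} (c : Fin N → ℝ) : 0 < nbDistSq N c := by
  by_contra hle
  push Not at hle
  rw [nbDistSq_eq_head_add_tail] at hle
  have hhead : 0 ≤ ∫ x in Set.Ioc (0 : ℝ) 1, (1 - ∑ k : Fin N, c k * nbRho k x) ^ 2 :=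
    setIntegral_nonneg measurableSet_Ioc fun x _ ↦ sq_nonneg _
  have hτsq : tailConst c ^ 2 = 0 := le_antisymm (by nlinarith [sq_nonneg (tailConst c)]) (sq_nonneg _)
  have hτ : tailConst c = 0 := pow_eq_zero_iff two_ne_zero |>.1 hτsq
  have h0 : ∫ x in Set.Ioc (0 : ℝ) 1, (1 - ∑ k : Fin N, c k * nbRho k x) ^ 2 = 0 := by linarith
  have hD : ∀ n : ℕ, ∑ k : Fin N, c k * (((n + 1) / ((k : ℕ) + 1) : ℕ) : ℝ) = -1 := fun n ↦ by
    linarith [const_add_sum_floor_eq_zero c 1 hτ h0 n]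
  have hdiff : ∀ m : ℕ, 1 ≤ m → ∑ k : Fin N, (if (k : ℕ) + 1 ∣ m + 1 then c k else 0) = 0 := by
    intro m hm
    obtain ⟨m', rfl⟩ := Nat.exists_eq_add_of_le' hm
    rw [← sum_floor_succ_sub c (m' + 1), hD (m' + 1), hD m', sub_self]
  have hone : ∑ k : Fin N, (if (k : ℕ) + 1 ∣ 0 + 1 then c k else 0) = -1 := by
    rw [← sum_floor_succ_sub c 0, hD 0, sum_floor_zero, sub_zero]
  rcases Nat.eq_zero_or_pos N with hN | hN
  · subst hN
    simp at hone
  · obtain ⟨p, hNp, hp⟩ := Nat.exists_infinite_primes (N + 1)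
    have hp2 : 2 ≤ p := hp.two_le
    -- at `m + 1 = 1`: the sum is `c_0`
    have e1 : c ⟨0, hN⟩ = -1 := by
      rw [← hone]
      exact (sum_ite_dvd_eq_head c hN fun d hd _ ↦ Nat.dvd_one.1 hd).symm
    -- at `m + 1 = p`: the sum is `c_0` as well
    have e2 : c ⟨0, hN⟩ = 0 := by
      have h := hdiff (p - 1) (by omega)
      rw [Nat.sub_add_cancel (by omega)] at h
      rw [← h]
      refine (sum_ite_dvd_eq_head c hN fun d hd hdN ↦ ?_).symm
      rcases hp.eq_one_or_self_of_dvd d hd with h1 | h1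
      · exact h1
      · omega
    linarith

/-- **`d_N² ≤ 1`** (the zero vector is a competitor). -/
theorem nbDistSq_nbMinimiser_le_one (N : ℕ) : nbDistSq N (nbMinimiser N) ≤ 1 := by
  have h := nbDistSq_nbMinimiser_le (N := N) 0
  have h0 : nbDistSq N 0 = 1 := by
    rw [nbDistSq_eq_quadratic]
    simp
  linarith

/-- **T3 for the DATA object (RH-FREE per N).**  The tail-constant identity of rung L-P(P2) (`NbTailConstIdentity`, route
NymanBeurlingTail, CLOSED) read on `c⋆_N = G⁻¹ b`: `(1 + Q)·tailConst(c⋆_N) = (1 − γ) − Σ_k c⋆_k ⟨ρ_{k+1}, h⟩`. -/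
theorem nbTailConstIdentity_nbMinimiser {N : ℕ} (hN : 1 ≤ N) :
    (1 + nbQ) * tailConst (nbMinimiser N) =
      (1 - Real.eulerMascheroniConstant) - ∑ k : Fin N, nbMinimiser N k * nbRhoH k :=
  nbTailConstIdentity_holds N (nbMinimiser N) hN (nbMinimiser_normalEq N)

/-- **Tail leverage for the DATA object:** `(2 − 2 log²2)·tailConst(c⋆_N)² ≤ d_N²`, i.e. `κ_N²·d_N² ≤ 1/(2 − 2log²2)`
(T1 `nbTailConstLeDist` read on `c⋆_N`). -/
theorem tailConst_nbMinimiser_sq_le (N : ℕ) :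
    (2 - 2 * Real.log 2 ^ 2) * tailConst (nbMinimiser N) ^ 2 ≤ nbDistSq N (nbMinimiser N) :=
  nbTailConstLeDist N (nbMinimiser N)

end Summit.RiemannHypothesis.RiemannHypothesis.Theorems.NbTheory

end
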